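import Summits.ABC.StewartYu.ArchG3LineSupply
import HarnessLib

/-!
# Cell abc-stewartyu, WP-L.A (crux r2 `ArchCoreRat`, stmt-ABC-20502), line `arch-g3-frame` v6: the SUPPLIES on a SHAPED saturated frame with the
# PATH BOUND `|C| ≤ 2^{n−1}·N` (plan RULING R49 (R-d): the adjugate letter `(n−1)!·N` of the S-texts is not n-uniform; registrar p4 g10)

`Summits/ABC/StewartYu/ArchG3LineSupplyS.lean` — sequel of `ArchG3LineSupply.lean` (same vocabulary; `RecordSupply`, `EndLetters`, the
`ν`-injectivity and `endLetters_holds` are reused from there).  Plain `Prop`-valued definitions (the REGISTERED texts of the two open stubs of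
the r2 line) and the composition theorem; no named fact, no numerics.

WHY THIS SEQUEL (p1 g11 21:45:31Z finding, plan R49): with the adjugate letter `|C j k| ≤ (n−1)!·N` of the S-texts the START print
`cP ⊇ log DΔC(YR₀, T₀) ≥ T₀·log((n−1)!)` grows like `L·n·log n` while the `c`-free zeros gain is `Θ(2ⁿ·G·X·L)` with `X = Θ(n + W_N)`, so
for FIXED `c` the far line (F) of the half-step family fails for `n ≳ c^{3.8}` — the closed lines are not provable for all `n` at any fixed
`c₀`.  The repair (R-d) is the PATH BOUND for the inverse of a pivot-reduced lower-triangular `U`: `|C j k| ≤ 2^{n−1}·N` (only increasing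
index paths contribute to `N·U⁻¹`), whose cost `T₀·(n−1)·log 2` is paid by `X ≥ 64(n+1)`.  So the third shape letter becomes
`∀ j k, |F.C j k| ≤ 2^{n−1}·F.N` (supplied by p5's pivot-reduced kit); the other three letters and everything else are the S-texts verbatim:

* **`StartSupplyS₂ c`** (stub `stub_satStartArch`, v6) — `StartDataS₂` = `StartData` + the four shape conjuncts (path bound as third);
* **`LinesSupplyS₂ c`** (stub `stub_recLinesArch`, v6; p5/p1/p4) — `LinesSupply` + the four shape hypotheses (path bound as third);
* `frameArchW_of_suppliesS₂ : StartSupplyS₂ c → LinesSupplyS₂ c → (record at c) → EndLetters → ∀ n ≥ 2, ∃ Y, FrameArchW (c^·) Y n`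
  (the shape letters are passed from the START to the lines; the rest of the composition is unchanged).

WHAT THIS IS NOT: no START, no lines (those are the stubs); no crux moves by itself.

References: Yu. V. Nesterenko, LNM 1819 (2003), §3.4–3.5 (Hermite-reduced basis of 𝔑, pp. 66–78), §4 Prop. 4.1, §4.3 Cor. 4.5, §5.1–5.2;
E. M. Matveev, Izv. Math. 64 (2000), (1.3); J. W. S. Cassels, *Geometry of Numbers*, Ch. I §2.2 (Hermite normal form).
-/

noncomputable section

open Finset
open scoped Matrix
open Summit.ABC.StewartYu.GenThreeFrameSpecArchW (RecordArchW FrameArchW)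
open Summit.ABC.StewartYu.FeldmanBasis (feldR)
open Summit.ABC.StewartYu.ArchG3FrameGlue (setupOf)

namespace Summit.ABC.StewartYu.ArchG3Line

/-! ### The supplies on a shaped frame (registered texts of the open stubs) -/

/-- **What the START owes for one datum at the constant `c`, WITH THE SHAPE LETTERS of the Hermite-reduced LOWER-triangular basis**
(`U k j = 0` for `k < j`, `0 ≤ U ≤ N`, the path bound `|C| ≤ 2^{n−1}·N`, pivot `j̃₀` = the LAST index = maximal weight; see the module docstring). [cite: Nesterenko2003, §3.5 (3.22)–(3.30),
Prop. 3.9, §4 (4.6); shape only] -/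
def StartDataS₂ (c : ℝ) (n : ℕ) (a : Fin n → ℚ) (b : Fin n → ℤ) (A : Fin n → ℝ) (B : ℝ) : Prop :=
  ∃ (θ : Fin n → ℚ) (hθ : ∀ i, 0 < θ i) (bt : Fin n → ℤ) (jt : Fin n) (hjt : bt jt ≠ 0)
    (F : (setupOf n θ hθ bt jt hjt).SatData) (P : ArchG3Rec n),
    F.αo = a ∧ F.bo = b ∧ P.A = A ∧ P.N = F.N ∧ F.C.det.natAbs = F.N ∧ P.W = Real.log (Real.exp 1 * B) ∧
    (∀ k j : Fin n, k < j → F.U k j = 0) ∧ (∀ k j : Fin n, 0 ≤ F.U k j ∧ F.U k j ≤ (F.N : ℤ)) ∧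
    (∀ j k : Fin n, |F.C j k| ≤ (2 : ℤ) ^ (n - 1) * F.N) ∧ (∀ j : Fin n, j ≤ jt) ∧
    (∀ T₁ : Finset (Fin n), T₁.Nonempty → ¬ IsSquare (∏ j ∈ T₁, θ j)) ∧
    |(setupOf n θ hθ bt jt hjt).Λ / (bt jt : ℝ)| ≤ Real.exp (-(c ^ n * P.Ω * P.W)) ∧
    ∀ (cl : ℕ → ℤ) (el : ℕ → Fin n → ℤ), cl 0 ≠ 0 → el 0 jt = 0 →
      ∃ (𝔏 : Finset (Fin n → ℤ)) (pv : ℕ × (Fin n → ℤ) → ℤ),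
        (∀ i ∈ (setupOf n θ hθ bt jt hjt).unkA P.L₀ 𝔏, i.1 ≤ P.L₀) ∧
        ((setupOf n θ hθ bt jt hjt).unkA P.L₀ 𝔏).card ≤ (P.L₀ + 1) * ∏ j, ((setupOf n θ hθ bt jt hjt).LνR P 0 j + 1) ∧
        (setupOf n θ hθ bt jt hjt).ArchLevelStateQ
          ((setupOf n θ hθ bt jt hjt).VBoxQ (Matrix.vecMulLinear F.U).toAddMonoidHom ((setupOf n θ hθ bt jt hjt).LνR P))
          P.H P.Sd ((setupOf n θ hθ bt jt hjt).sθR F P) ((setupOf n θ hθ bt jt hjt).unkA P.L₀ 𝔏) pv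
          ⌈((((setupOf n θ hθ bt jt hjt).unkA P.L₀ 𝔏).card : ℕ) : ℝ) * (setupOf n θ hθ bt jt hjt).AmaxR F P (cl 0) (el 0)⌉
          P.wl P.γb cl el 0 (P.Nf 0 0) (P.Tf 0 0)

/-- **THE START SUPPLY at the constant `c`, shape letters included** (text of `stub_satStartArch`, v4): every REDUCED pivot-weighted rank-`n` datum (`n ≥ 2`) under the
negated bound `log|Λ| < −cⁿ·Ω·log(eB)` and in the regime `cⁿ·Ω·log(eB) < Σ Aⱼ|bⱼ| + log 2` receives `StartDataS₂ c n a b A B`.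
[cite: Nesterenko2003, §3.5, §4 (4.6); shape only] -/
def StartSupplyS₂ (c : ℝ) : Prop :=
  ∀ n, 2 ≤ n → ∀ (a : Fin n → ℚ) (b : Fin n → ℤ) (A : Fin n → ℝ) (B : ℝ) (k₀ : Fin n),
    (∀ j, 0 < a j) →
    (∀ μ : Fin n → ℤ, ∏ j, a j ^ μ j = 1 → μ = 0) →
    (∀ j, Height.logHeight₁ (a j) ≤ A j) → (∀ j, 1 ≤ A j) →
    (∀ j, b j ≠ 0) → Finset.univ.gcd b = 1 → Monotone A → (∀ j, A j ≤ A k₀) →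
    (∀ j, (|b j| : ℝ) * A j ≤ B * A k₀) →
    ¬ -(c ^ n * (∏ j, A j) * Real.log (Real.exp 1 * B)) ≤ Real.log |∑ j, (b j : ℝ) * Real.log (a j : ℝ)| →
    c ^ n * (∏ j, A j) * Real.log (Real.exp 1 * B) < ∑ j, A j * |(b j : ℝ)| + Real.log 2 →
    StartDataS₂ c n a b A B

/-- **THE LETTER-LINES SUPPLY at the constant `c`, on a SHAPED frame** (text of `stub_recLinesArch`, v4): for every datum as in `StartSupply` and every START output
`(θ, b̃, j̃₀, F, P)` on the datum's letters, a direction schedule `(cl, el)` with `cl 0 ≠ 0`, `el 0 j̃₀ = 0` such that for every Siegel family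
`𝔏` within the START's degree/count bounds (and non-empty) the per-level letter lines `ArchLinesHoldV` hold at the record's schedules with
`δ₀ := exp(−cⁿ·P.Ω·P.W)`; the frame carries the four SHAPE letters (lower-triangular `U`, Hermite box, path bound `2^{n−1}·N`, last-index pivot),
without which the lines are false for skew bases (p5 g9 Claim 1, ref g37 21:13Z/21:27Z). [cite: Nesterenko2003, §4.2 (4.20)–(4.35), §4.3 (4.36)–(4.51); shape only] -/
def LinesSupplyS₂ (c : ℝ) : Prop :=
  ∀ n, 2 ≤ n → ∀ (a : Fin n → ℚ) (b : Fin n → ℤ) (A : Fin n → ℝ) (B : ℝ) (k₀ : Fin n),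
    (∀ j, 0 < a j) →
    (∀ μ : Fin n → ℤ, ∏ j, a j ^ μ j = 1 → μ = 0) →
    (∀ j, Height.logHeight₁ (a j) ≤ A j) → (∀ j, 1 ≤ A j) →
    (∀ j, b j ≠ 0) → Finset.univ.gcd b = 1 → Monotone A → (∀ j, A j ≤ A k₀) →
    (∀ j, (|b j| : ℝ) * A j ≤ B * A k₀) →
    ¬ -(c ^ n * (∏ j, A j) * Real.log (Real.exp 1 * B)) ≤ Real.log |∑ j, (b j : ℝ) * Real.log (a j : ℝ)| →
    c ^ n * (∏ j, A j) * Real.log (Real.exp 1 * B) < ∑ j, A j * |(b j : ℝ)| + Real.log 2 →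
    ∀ (θ : Fin n → ℚ) (hθ : ∀ i, 0 < θ i) (bt : Fin n → ℤ) (jt : Fin n) (hjt : bt jt ≠ 0)
      (F : (setupOf n θ hθ bt jt hjt).SatData) (P : ArchG3Rec n),
      F.αo = a → F.bo = b → P.A = A → P.N = F.N → F.C.det.natAbs = F.N → P.W = Real.log (Real.exp 1 * B) →
      (∀ k j : Fin n, k < j → F.U k j = 0) → (∀ k j : Fin n, 0 ≤ F.U k j ∧ F.U k j ≤ (F.N : ℤ)) →
      (∀ j k : Fin n, |F.C j k| ≤ (2 : ℤ) ^ (n - 1) * F.N) → (∀ j : Fin n, j ≤ jt) →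
      (∀ T₁ : Finset (Fin n), T₁.Nonempty → ¬ IsSquare (∏ j ∈ T₁, θ j)) →
      ∃ (cl : ℕ → ℤ) (el : ℕ → Fin n → ℤ), cl 0 ≠ 0 ∧ el 0 jt = 0 ∧
        ∀ (𝔏 : Finset (Fin n → ℤ)),
          (∀ i ∈ (setupOf n θ hθ bt jt hjt).unkA P.L₀ 𝔏, i.1 ≤ P.L₀) →
          ((setupOf n θ hθ bt jt hjt).unkA P.L₀ 𝔏).card ≤ (P.L₀ + 1) * ∏ j, ((setupOf n θ hθ bt jt hjt).LνR P 0 j + 1) →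
          1 ≤ ((setupOf n θ hθ bt jt hjt).unkA P.L₀ 𝔏).card →
          (setupOf n θ hθ bt jt hjt).ArchLinesHoldV F P.H P.Sd ((setupOf n θ hθ bt jt hjt).sθR F P)
            ((setupOf n θ hθ bt jt hjt).unkA P.L₀ 𝔏)
            ⌈((((setupOf n θ hθ bt jt hjt).unkA P.L₀ 𝔏).card : ℕ) : ℝ) * (setupOf n θ hθ bt jt hjt).AmaxR F P (cl 0) (el 0)⌉
            (Real.exp (-(c ^ n * P.Ω * P.W))) P.wl P.γb cl el ((setupOf n θ hθ bt jt hjt).LνR P) P.Nf P.Tf P.Nh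

/-! ### Composition -/

/-- **THE COMPOSITION (shaped frame)**: at a constant `c`, the START supply, the letter-lines supply, a record supply at this `c` and the END letters give the
archimedean frame `FrameArchW (c^·) Y n` at every rank `n ≥ 2` — lines ⇒ packs (✓ `archPacksHoldV_of_linesHoldV`), packs ⇒ last level
(✓ `lastLevelStateQ_of_packsV` with `Q := VBoxQ`, hooks ✓ `vboxQ_halfStep`/`vboxV_of_vboxQ`), last level ⇒ `EndAt` (✓ `lastLevelInv_feldR`,
box enlarged to the END degrees), `EndAt` ⇒ frame (✓ `frameArchW_of_endAt`). [cite: Nesterenko2003, §4 Prop. 4.1, §5.1–5.2] -/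
theorem frameArchW_of_suppliesS₂ {c : ℝ} (hS : StartSupplyS₂ c) (hL : LinesSupplyS₂ c)
    (hR : ∀ n : ℕ, 2 ≤ n → ∃ Y : ℕ → ℝ, ∀ P : ArchG3Rec n, RecordArchW (fun r => c ^ r) Y n P.A P.D₀ P.S₀ P.Xfin P.D)
    (hE : EndLetters) : ∀ n, 2 ≤ n → ∃ Y : ℕ → ℝ, FrameArchW (fun r => c ^ r) Y n := by
  classical
  intro n hn
  obtain ⟨Y, hY⟩ := hR n hn
  refine ⟨Y, ?_⟩
  intro a b A B k₀ ha hind hA hA1 hbz hgcd hmono hmax hBw hneg hreg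
  obtain ⟨θ, hθ, bt, jt, hjt, F, P, hαo, hbo, hPA, hPN, hdet, hPW, hUtri, hUbox, hCbd, hlast, hindθ, hΛ, hstart⟩ :=
    hS n hn a b A B k₀ ha hind hA hA1 hbz hgcd hmono hmax hBw hneg hreg
  obtain ⟨cl, el, hc0, he0, hlines⟩ :=
    hL n hn a b A B k₀ ha hind hA hA1 hbz hgcd hmono hmax hBw hneg hreg θ hθ bt jt hjt F P hαo hbo hPA hPN hdet hPW
      hUtri hUbox hCbd hlast hindθ
  obtain ⟨𝔏, pv, hdeg, hcount, h00⟩ := hstart cl el hc0 he0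
  -- the unknown set is non-empty (the level-`0` function is non-zero)
  have hU1 : 1 ≤ ((setupOf n θ hθ bt jt hjt).unkA P.L₀ 𝔏).card := by
    obtain ⟨B₀, v₀, lo₀, γ₀, hBU₀, -, -, hinv₀, -⟩ := h00
    obtain ⟨i, hi, -⟩ := hinv₀.nonzero
    exact Finset.card_pos.mpr ⟨i, hBU₀ hi⟩
  have hlin := hlines 𝔏 hdeg hcount hU1
  have hpacks := (setupOf n θ hθ bt jt hjt).archPacksHoldV_of_linesHoldV F hlin
  -- the schedule hooks
  have hn1 : 1 ≤ (setupOf n θ hθ bt jt hjt).n := by show 1 ≤ n; omega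
  have hΛ' : |(setupOf n θ hθ bt jt hjt).Λ / ((setupOf n θ hθ bt jt hjt).b (setupOf n θ hθ bt jt hjt).j₀ : ℝ)| ≤ Real.exp (-(c ^ n * P.Ω * P.W)) := hΛ
  have hQhalf : ∀ (lev : ℕ) (B₁ : Finset (ℕ × (Fin n → ℤ))) (v : ℕ × (Fin n → ℤ) → Fin n → ℤ) (i₀ : ℕ × (Fin n → ℤ)),
      i₀ ∈ B₁ → (setupOf n θ hθ bt jt hjt).VBoxQ (Matrix.vecMulLinear F.U).toAddMonoidHom ((setupOf n θ hθ bt jt hjt).LνR P) B₁ v lev →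
      (setupOf n θ hθ bt jt hjt).VBoxQ (Matrix.vecMulLinear F.U).toAddMonoidHom ((setupOf n θ hθ bt jt hjt).LνR P) ((setupOf n θ hθ bt jt hjt).parityClass v B₁ i₀) ((setupOf n θ hθ bt jt hjt).halfDiff v i₀) (lev + 1) :=
    fun lev B₁ v i₀ hi₀ hQ => ArchG3Setup.vboxQ_halfStep (fun j => (setupOf n θ hθ bt jt hjt).LνR_succ P lev j) hi₀ hQ
  have hQV : ∀ (lev : ℕ) (B₁ : Finset (ℕ × (Fin n → ℤ))) (v : ℕ × (Fin n → ℤ) → Fin n → ℤ),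
      (setupOf n θ hθ bt jt hjt).VBoxQ (Matrix.vecMulLinear F.U).toAddMonoidHom ((setupOf n θ hθ bt jt hjt).LνR P) B₁ v lev → ∀ i ∈ B₁, ∀ j, |(v i ᵥ* F.U) j| ≤ ((setupOf n θ hθ bt jt hjt).LνR P lev j : ℤ) :=
    fun lev B₁ v hQ i hi j => ArchG3Setup.vboxV_of_vboxQ lev B₁ v hQ i hi j
  have hwl : ∀ lev, P.wl (lev + 1) = P.wl lev / 2 := fun lev => (P.wl_facts lev).1
  have hγb : ∀ lev, P.wl lev / 2 ≤ P.γb (lev + 1) := fun lev => (P.γb_facts lev).2.2.1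
  have hlast := (setupOf n θ hθ bt jt hjt).lastLevelStateQ_of_packsV F hn1 hindθ hΛ' hQhalf hQV hwl hγb hpacks h00
  obtain ⟨Bf, v, lo, γ, hBU, hinj, hinv, hQ⟩ := ArchG3Setup.lastLevelInv_feldR hlast
  -- the END letters and the record
  obtain ⟨hLD, hL0D0, hX, hSlt⟩ := hE (setupOf n θ hθ bt jt hjt) P
  have hrec : RecordArchW (fun r => c ^ r) Y n A P.D₀ P.S₀ P.Xfin P.D := by rw [← hPA]; exact hY P
  -- the saturation relations over the original datum
  have hN1 : 1 ≤ F.N := F.hN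
  have hUrel : ∀ i, θ i ^ F.N = ∏ j, a j ^ F.U i j := by
    intro i; rw [← hαo]; exact F.hU i
  have hbU : bt ᵥ* F.U = (F.N : ℤ) • b := by
    rw [← hbo]; exact F.N_smul_bo_eq.symm
  have hνinj := vecMul_U_injective F
  have hdegD : ∀ i ∈ Bf, i.1 ≤ P.D₀ := fun i hi => (hdeg i (hBU hi)).trans hL0D0
  have hbox : ∀ i ∈ Bf, ∀ j, |(v i ᵥ* F.U) j| ≤ (P.D j : ℤ) := by
    intro i hi j
    have h1 := hQV P.Sd Bf v hQ i hi j
    have h2 : ((setupOf n θ hθ bt jt hjt).LνR P P.Sd j : ℤ) ≤ (P.D j : ℤ) := by exact_mod_cast hLD j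
    exact h1.trans h2
  have hEnd : EndAt c Y n a b A :=
    ⟨θ, hθ, bt, jt, hjt, F.U, F.N, P.H, Bf, v, pv, lo, (setupOf n θ hθ bt jt hjt).Lb ((setupOf n θ hθ bt jt hjt).sθR F P) P.Sd,
      ⌈((((setupOf n θ hθ bt jt hjt).unkA P.L₀ 𝔏).card : ℕ) : ℝ) * (setupOf n θ hθ bt jt hjt).AmaxR F P (cl 0) (el 0)⌉, P.wl P.Sd, γ, cl P.Sd, el P.Sd,
      P.Nf P.Sd n, P.Tf P.Sd n, P.D₀, P.S₀, P.Xfin, P.D, hN1, hUrel, hbU, hνinj, hinv, hdegD, hinj, hbox, hX, hSlt, hrec⟩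
  exact frameArchW_of_endAt c Y n a b A k₀ ha hind (hbz k₀) hEnd


end Summit.ABC.StewartYu.ArchG3Line

end
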